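import Literature.IUT.LogThetaLattice.TimesMuSideOfStrips
import Literature.IUT.LogThetaLattice.ThetaMonoids

/-!
# `ThetaMonoidData.ofKits`: the theta-monoid data of [IUTchIII] Prop 2.1 / Thm 2.2 over the frame ASSEMBLED from the [IUTchI] kits

Mochizuki, *Inter-universal Teichmüller Theory III*, kurims manuscript (May 2020), §2, Prop 2.1 (i)–(vi) pp. 58–61,
Thm 2.2 (i)–(iii) pp. 65–67; *II* (Dec 2020), Cor 4.5 (iv)(v) pp. 132–133, Cor 4.6 (iv)(v) p. 137, Cor 4.10 (ii)(iv)
pp. 159–160. ([IUTchIII] Prop 2.1 (ii) p.58) [claim: Mochizuki2012, status: disputed]. MERGE-MAP plan/L6/MERGE-MAP.md §1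
row 131 («`ThetaMonoidData` (functor slots; Cor 4.5/4.6/4.10) … bridge when L5-t4 FKit + t2 data land»). Consumer seat
abc-iut-L6-t3 (gen 4). Nothing of the series is asserted; typed ≠ discharged.

`Literature.IUT.LogThetaLattice.ThetaMonoidData S` (`ThetaMonoids.lean`, this seat, gen 0) is the INTERFACE over a strip frame
`S` recording the étale-like theta monoids `Ψ_{env}(†D_>)`, `_∞Ψ_{env}(†D_>)`, `D^⊩_{env}(†D^⊢_>)` [Prop 2.1 (i); IUTchII Cor 4.5
(iv)(v)], their Frobenius-like counterparts with the Kummer isomorphisms [Prop 2.1 (ii); Cor 4.6 (iv)(v)], the strips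
`F^⊩_{env}(†D_>)`, `†F^⊩_{env}` [Cor 4.10 (ii)], the unit-portion identification [Prop 2.1 (vi)] and [IUTchIII] Thm 2.2 (i)'s
surjectivity `Aut(F^{⊩▶×μ}) ↠ Aut(F^{⊢×μ})` (field `mapAut_surjective`); it is the `thetaMonoid` field of `LatticeGlue S` (this
seat), the input of the Cor 3.12 crew's `Summit.ABC.IUTFork.Thm311.LinkData.ofGlue`.

This file supplies the CONSTRUCTOR over the real frame `StripFrame.ofKits L hbij hsurj hR X` (`StripFrameOfKits`):
* `ThetaMonoidKit X` — the same data at KIT LEVEL (functors on abc-iut-L5-t4's `K.DStrip`, `M.DMono`, `FK.FrStrip`, the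
  [IUTchII] Def 4.9 input's `X.Fxm`, and this seat's `HTRep FK`, `DHTRep K`; every field quotes the `ThetaMonoidData` field
  it instantiates). INPUT BY NAME: the genuine algorithms are abc-iut-L6-t2's [IUTchII] §3–§4 constructions
  (`TemperedThetaMonoids`, `GaussianMonoids*`, `Cor45Statements`/`Cor46Statements`) over abc-iut-L6-t1's mono-theta
  environments — to be plugged in when their outputs are functors on the kits' (abstract) categories (TODO-merge
  abc-iut-L6-t2 / abc-iut-L6-t1);
* `ThetaMonoidData.ofKits` — transport along `AsSmall` (functors by `liftF`, the printed Kummer / unit-portion NATURAL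
  isomorphisms componentwise), the label `> := PUnit.unit` (the frame's one label; `>` is identified with `≻` along the
  gluing of [IUTchI] Rmk 6.12.2 (i) — DISCLOSED TRUNCATION (1) of `StripFrameOfKits`), and the field `mapAut_surjective`
  ([IUTchIII] Thm 2.2 (i) "the second arrows in each line are surjections") NOT an input: it is abc-iut-w4-d028's
  `StripFrame.ofKits_mapAut_surjective` under the ONE iso-surjectivity hypothesis `h` on the Def 4.9 input `X`
  (`StripFrameOfKitsFullness`), and over `X := TimesMuSide.ofPassages L hR Ps` (`TimesMuSideOfStrips`) that hypothesis
  is the theorem `TimesMuSide.ofPassages_mapIso_surjective` — `ThetaMonoidData.ofPassages` takes NO [IUTchII]-side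
  hypothesis.
Universe-generic in the kit for `ofKits` (`K : PMBaseKit.{u} l`); `ofPassages` lives at the kit universe `max (v+1) w` of
`TimesMuSideOfStrips`.
-/

namespace Literature.IUT.LogThetaLattice

open CategoryTheory
open Literature.IUT.HodgeTheaters Literature.IUT.HodgeTheaters.PMBaseKit
open Literature.IUT.HodgeArakelov
open AsSmallTransport

universe u v w

section Kit

variable {l : ℕ} {K : PMBaseKit.{u} l} {M : K.MultKit} {FK : K.FKit M} {L : FK.MonoLaws}

/-! ### 1. The kit-level data -/

/-- **IUTchIII:Prop2.1(ii)** (kurims p.58) KIT-LEVEL INPUT for `ThetaMonoidData` over the assembled frame: the data of this seat's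
interface `ThetaMonoidData` ([IUTchIII] Prop 2.1 (i)(ii)(vi); [IUTchII] Cor 4.5 (iv)(v), 4.6 (iv)(v), 4.10 (ii)) as functors /
natural isomorphisms on abc-iut-L5-t4's kit categories (`K.DStrip`, `M.DMono`, `FK.FrStrip`), the [IUTchII] Def 4.9 input's
categories (`X.Fxm` via `X.FglToFglxm ⋙ X.FglxmToFvtxm ⋙ X.FvtxmToFxm`) and the representative-level Hodge-theater groupoids
`HTRep FK`, `DHTRep K` (`†ℋ𝒯 ↦ †ℋ𝒯^𝒟 ↦ †𝔇_>`: `HTRep.toDFunctor ⋙ DHTRep.codFunctor`, the label `>` identified with `≻`). Each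
field quotes the `ThetaMonoidData` field it instantiates. Thm 2.2 (i)'s surjectivity is NOT a field (it is a theorem over
the assembled frame, see `ThetaMonoidData.ofKits`). INPUT BY NAME (owners abc-iut-L6-t2 / abc-iut-L6-t1; TODO-merge).
([IUTchIII] Prop 2.1 (ii) p.58) [claim: Mochizuki2012, status: disputed] -/
structure ThetaMonoidKit (X : TimesMuSide FK L) : Type (u + 1) where
  /-- `ThetaMonoidData.TM`: collections `{Ψ_v}_{v∈𝕍}` of theta monoids with Galois actions [IUTchII, Cor 4.5 (iv)] -/
  TM : Type u
  [catTM : Category.{u} TM]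
  /-- `ThetaMonoidData.RF`: data `(C^⊩, Prime(C^⊩) ⥲ 𝕍, local isomorphisms)` [IUTchII, Cor 4.5 (v)] -/
  RF : Type u
  [catRF : Category.{u} RF]
  /-- `ThetaMonoidData.ΨenvD`: Prop 2.1 (i) `†𝔇_> ↦ Ψ_{env}(†𝔇_>)` on the kit's `𝒟`-prime-strips -/
  ΨenvD : K.DStrip ⥤ TM
  /-- `ThetaMonoidData.ΨenvInfD`: Prop 2.1 (i) `†𝔇_> ↦ _∞Ψ_{env}(†𝔇_>)` -/
  ΨenvInfD : K.DStrip ⥤ TM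
  /-- `ThetaMonoidData.DglEnv`: Prop 2.1 (i) `†𝔇^⊢_> ↦ D^⊩_{env}(†𝔇^⊢_>)` on the kit's `𝒟^⊢`-prime-strips -/
  DglEnv : M.DMono ⥤ RF
  /-- `ThetaMonoidData.ΨFenv`: Prop 2.1 (ii) `†ℋ𝒯 ↦ Ψ_{F_{env}}(†ℋ𝒯^Θ)` (Frobenius-like) -/
  ΨFenv : HTRep FK ⥤ TM
  /-- `ThetaMonoidData.ΨFenvInf`: Prop 2.1 (ii) `†ℋ𝒯 ↦ _∞Ψ_{F_{env}}(†ℋ𝒯^Θ)` -/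
  ΨFenvInf : HTRep FK ⥤ TM
  /-- `ThetaMonoidData.CglEnv`: Prop 2.1 (ii) `†ℋ𝒯 ↦ C^⊩_{env}(†ℋ𝒯^Θ)` -/
  CglEnv : HTRep FK ⥤ RF
  /-- `ThetaMonoidData.kummerΨ`: the Kummer isomorphism `Ψ_{F_{env}}(†ℋ𝒯^Θ) ⥲ Ψ_{env}(†𝔇_>)`, functorial in `†ℋ𝒯` -/
  kummerΨ : ΨFenv ≅ (HTRep.toDFunctor ⋙ DHTRep.codFunctor) ⋙ ΨenvD
  /-- `ThetaMonoidData.kummerΨInf`: the Kummer isomorphism `_∞Ψ_{F_{env}}(†ℋ𝒯^Θ) ⥲ _∞Ψ_{env}(†𝔇_>)` -/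
  kummerΨInf : ΨFenvInf ≅ (HTRep.toDFunctor ⋙ DHTRep.codFunctor) ⋙ ΨenvInfD
  /-- `ThetaMonoidData.kummerC`: the Kummer isomorphism `C^⊩_{env}(†ℋ𝒯^Θ) ⥲ D^⊩_{env}(†𝔇^⊢_>)` (`𝔇 ↦ 𝔇^⊢` = abc-iut-L6-t7's
  `monoDFunctor L`) -/
  kummerC : CglEnv ≅ ((HTRep.toDFunctor ⋙ DHTRep.codFunctor) ⋙ PrimeStripGroupoids.monoDFunctor L) ⋙ DglEnv
  /-- `ThetaMonoidData.FglEnvD`: Prop 2.1 (ii) `†𝔇_> ↦ F^⊩_{env}(†𝔇_>)` into the kit's `ℱ^⊩`-prime-strips -/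
  FglEnvD : K.DStrip ⥤ FK.FrStrip
  /-- `ThetaMonoidData.FglEnvHT`: [IUTchII] Cor 4.10 (ii) `†ℋ𝒯 ↦ †𝔉^⊩_{env}` (Frobenius-like) -/
  FglEnvHT : HTRep FK ⥤ FK.FrStrip
  /-- `ThetaMonoidData.kummerFgl`: Prop 2.1 (ii), last display "`†𝔉^⊩_{env} ⥲ F^⊩_{env}(†𝔇_>)`", functorial in `†ℋ𝒯` -/
  kummerFgl : FglEnvHT ≅ (HTRep.toDFunctor ⋙ DHTRep.codFunctor) ⋙ FglEnvD
  /-- `ThetaMonoidData.fxmDeltaD`: Thm 1.5 (iii) / Prop 2.1 (vi) `†ℋ𝒯^𝒟 ↦ †𝔇^⊢_△ ↦ F^{⊢×μ}_△(†𝔇^⊢_△)` -/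
  fxmDeltaD : DHTRep K ⥤ X.Fxm
  /-- `ThetaMonoidData.unitPortionD`: Prop 2.1 (vi) "natural isomorphisms … `F^{⊢×}_△(†𝔇^⊢_△) ⥲ F^{⊢×}_{env}(†𝔇_>)`" on associated
  `F^{⊢×μ}`-prime-strips, functorial in `†ℋ𝒯^𝒟` (`F^⊩ ↦ F^{⊩▶×μ} ↦ F^{⊢▶×μ} ↦ F^{⊢×μ}` = the Def 4.9 input's functors) -/
  unitPortionD : fxmDeltaD ≅ DHTRep.codFunctor ⋙ FglEnvD ⋙ X.FglToFglxm ⋙ X.FglxmToFvtxm ⋙ X.FvtxmToFxm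

attribute [instance] ThetaMonoidKit.catTM ThetaMonoidKit.catRF

/-! ### 2. The constructor -/

variable (L) (hbij : FK.IsomFtoDBijective) (hsurj : FK.IsomFmtoDmSurjective) (hR : FK.RlfOfIsStrip)
  (X : TimesMuSide FK L)

/-- **IUTchIII:Prop2.1(ii)** (kurims p.58) **`ThetaMonoidData.ofKits`** — this seat's [IUTchIII] §2 interface `ThetaMonoidData` (Prop 2.1,
Thm 2.2) INSTANTIATED over the real frame `StripFrame.ofKits L hbij hsurj hR X` from kit-level data `Tk : ThetaMonoidKit X`: categories
:= small models (`AsSmall`), functors := `liftF`, the Kummer / unit-portion natural isomorphisms componentwise, the label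
`> := PUnit.unit`; the field `mapAut_surjective` ([IUTchIII] Thm 2.2 (i)) := abc-iut-w4-d028's `StripFrame.ofKits_mapAut_surjective`
from the ONE iso-surjectivity hypothesis `h` on the Def 4.9 input ([IUTchII] Cor 4.10 (iv); discharged over
`TimesMuSide.ofPassages`, see `ThetaMonoidData.ofPassages`). ([IUTchIII] Prop 2.1 (ii) p.58) [claim: Mochizuki2012, status: disputed] -/
noncomputable def ThetaMonoidData.ofKits
    (h : ∀ A B : X.Fglxm, Function.Surjective (fun g : A ≅ B => (X.FglxmToFvtxm ⋙ X.FvtxmToFxm).mapIso g))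
    (Tk : ThetaMonoidKit X) : ThetaMonoidData (StripFrame.ofKits L hbij hsurj hR X) where
  TM := AsSmall.{max 1 u} Tk.TM
  RF := AsSmall.{max 1 u} Tk.RF
  gt := PUnit.unit
  ΨenvD := liftF Tk.ΨenvD
  ΨenvInfD := liftF Tk.ΨenvInfD
  DglEnv := liftF Tk.DglEnv
  ΨFenv := liftF Tk.ΨFenv
  ΨFenvInf := liftF Tk.ΨFenvInf
  CglEnv := liftF Tk.CglEnv
  kummerΨ := NatIso.ofComponents (fun H => AsSmall.up.mapIso (Tk.kummerΨ.app (ULift.down H)))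
    (fun f => ULift.ext _ _ (Tk.kummerΨ.hom.naturality f.down))
  kummerΨInf := NatIso.ofComponents (fun H => AsSmall.up.mapIso (Tk.kummerΨInf.app (ULift.down H)))
    (fun f => ULift.ext _ _ (Tk.kummerΨInf.hom.naturality f.down))
  kummerC := NatIso.ofComponents (fun H => AsSmall.up.mapIso (Tk.kummerC.app (ULift.down H)))
    (fun f => ULift.ext _ _ (Tk.kummerC.hom.naturality f.down))
  FglEnvD := liftF Tk.FglEnvD
  FglEnvHT := liftF Tk.FglEnvHT
  kummerFgl := NatIso.ofComponents (fun H => AsSmall.up.mapIso (Tk.kummerFgl.app (ULift.down H)))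
    (fun f => ULift.ext _ _ (Tk.kummerFgl.hom.naturality f.down))
  fxmDeltaD := liftF Tk.fxmDeltaD
  unitPortionD := NatIso.ofComponents (fun H => AsSmall.up.mapIso (Tk.unitPortionD.app (ULift.down H)))
    (fun f => ULift.ext _ _ (Tk.unitPortionD.hom.naturality f.down))
  mapAut_surjective := StripFrame.ofKits_mapAut_surjective L hbij hsurj hR X h

/-- **IUTchIII:Prop2.1(i)** (kurims p.58) In the instance, `Ψ_{env}(†𝔇_>)` of a `𝒟`-prime-strip of the frame IS (the small model of) the kit-level
one. ([IUTchIII] Prop 2.1 (i) p.58) [claim: Mochizuki2012, status: disputed] -/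
theorem ThetaMonoidData.ofKits_ΨenvD_obj
    (h : ∀ A B : X.Fglxm, Function.Surjective (fun g : A ≅ B => (X.FglxmToFvtxm ⋙ X.FvtxmToFxm).mapIso g))
    (Tk : ThetaMonoidKit X) (D : (StripFrame.ofKits L hbij hsurj hR X).D) :
    (ThetaMonoidData.ofKits L hbij hsurj hR X h Tk).ΨenvD.obj D = AsSmall.up.obj (Tk.ΨenvD.obj (ULift.down D)) := rfl

/-- **IUTchIII:Prop2.1(ii)** (kurims p.58) In the instance, the Kummer isomorphism `Ψ_{F_{env}}(†ℋ𝒯^Θ) ⥲ Ψ_{env}(†𝔇_>)` at a Hodge theater IS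
(the small model of) the kit-level one. ([IUTchIII] Prop 2.1 (ii) p.58) [claim: Mochizuki2012, status: disputed] -/
theorem ThetaMonoidData.ofKits_kummerΨAt
    (h : ∀ A B : X.Fglxm, Function.Surjective (fun g : A ≅ B => (X.FglxmToFvtxm ⋙ X.FvtxmToFxm).mapIso g))
    (Tk : ThetaMonoidKit X) (H : (StripFrame.ofKits L hbij hsurj hR X).HT) :
    (ThetaMonoidData.ofKits L hbij hsurj hR X h Tk).kummerΨAt H = AsSmall.up.mapIso (Tk.kummerΨ.app (ULift.down H)) := rfl

/-- **IUTchIII:Prop2.1(ii)** (kurims p.58) Hence the interface `ThetaMonoidData` over the real frame is INHABITED as soon as kit-level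
theta-monoid data are given, under the one hypothesis `h` on the Def 4.9 input. ([IUTchIII] Prop 2.1 (ii) p.58)
[claim: Mochizuki2012, status: disputed] -/
theorem nonempty_thetaMonoidData_ofKits
    (h : ∀ A B : X.Fglxm, Function.Surjective (fun g : A ≅ B => (X.FglxmToFvtxm ⋙ X.FvtxmToFxm).mapIso g))
    (hT : Nonempty (ThetaMonoidKit X)) : Nonempty (ThetaMonoidData (StripFrame.ofKits L hbij hsurj hR X)) :=
  ⟨ThetaMonoidData.ofKits L hbij hsurj hR X h hT.some⟩

end Kit

/-! ### 3. Over `TimesMuSide.ofPassages`: no [IUTchII]-side hypothesis -/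

section OfPassages

variable {l : ℕ} {K : PMBaseKit.{max (v + 1) w} l} {M : K.MultKit} {FK : K.FKit M}
  {P : PlaceData K.V} {G : K.V → Type} [∀ v, Group (G v)]
  {X : ∀ v, GroupTheoreticUnits.{0, w} (G v)} {S₀ : FVdashSplitTriMuPrimeStrip.{0, v, w} P G X}
  (L : FK.MonoLaws) (hbij : FK.IsomFtoDBijective) (hsurj : FK.IsomFmtoDmSurjective) (hR : FK.RlfOfIsStrip)
  (Ps : TimesMuPassages FK S₀)

/-- **IUTchIII:Thm2.2(i)** (kurims p.65) **`ThetaMonoidData.ofPassages`** — over the real frame built on abc-iut-L6-t2's print-level strip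
groupoids (`TimesMuSide.ofPassages L hR Ps`), `ThetaMonoidData` is instantiated from kit-level theta-monoid data with NO hypothesis
on the [IUTchII] side: Thm 2.2 (i)'s "the second arrows in each line are surjections" is the theorem
`TimesMuSide.ofPassages_mapIso_surjective` (`TimesMuSideOfStrips`). ([IUTchIII] Thm 2.2 (i) p.65) [claim: Mochizuki2012, status: disputed] -/
noncomputable def ThetaMonoidData.ofPassages (Tk : ThetaMonoidKit (TimesMuSide.ofPassages L hR Ps)) :
    ThetaMonoidData (StripFrame.ofKits L hbij hsurj hR (TimesMuSide.ofPassages L hR Ps)) :=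
  ThetaMonoidData.ofKits L hbij hsurj hR _ (TimesMuSide.ofPassages_mapIso_surjective L hR Ps) Tk

/-- **IUTchIII:Thm2.2(i)** (kurims p.65) … so over the print-level groupoids `ThetaMonoidData` is INHABITED as soon as kit-level
theta-monoid data are given. ([IUTchIII] Thm 2.2 (i) p.65) [claim: Mochizuki2012, status: disputed] -/
theorem nonempty_thetaMonoidData_ofPassages
    (hT : Nonempty (ThetaMonoidKit (TimesMuSide.ofPassages L hR Ps))) :
    Nonempty (ThetaMonoidData (StripFrame.ofKits L hbij hsurj hR (TimesMuSide.ofPassages L hR Ps))) :=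
  ⟨ThetaMonoidData.ofPassages L hbij hsurj hR Ps hT.some⟩

end OfPassages

end Literature.IUT.LogThetaLattice
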